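import Literature.Analysis.FluidPDE.FluidComputer.ThresholdLevelTableA5
import HarnessLib

/-!
# Kernel run of the A = 5 level-table checker, chunks 0 … 3 (steps 0 … 99) (bp3 gen 13, layer 4)

HONEST FRAMING: low prior, high value-of-information experiment on Tao's machine paradigm; NOT a
claim that NS blows up.

Four kernel evaluations (`decide +kernel`; no `native_decide`, no extra axioms) of the checker
`runSteps` (`ThresholdLevelCheck.lean`) on 25 steps of `ThresholdLevelTableA5.stepsT` at a time, from
the entry box `Bc i` towards the next chunk's first level, returning the entry box `Bc (i+1)`
(≈ 30 s of kernel time per chunk; same scheme as `ThresholdLevelTableRun0 … 7` for A = 2).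
-/

namespace Literature.Analysis.FluidPDE.FluidComputer

namespace ThresholdLevelTableA5

set_option maxHeartbeats 10000000 in
set_option maxRecDepth 200000 in
/-- Chunk 0 of the A = 5 table run (steps 0 … 24). [folklore] -/
theorem run0 : runSteps 60 12 3 GIt RbIt Bc0 chunk0 206105443385591 = some Bc1 := by
  decide +kernel

set_option maxHeartbeats 10000000 in
set_option maxRecDepth 200000 in
/-- Chunk 1 of the A = 5 table run (steps 25 … 49). [folklore] -/
theorem run1 : runSteps 60 12 3 GIt RbIt Bc1 chunk1 225610057520836 = some Bc2 := by
  decide +kernel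

set_option maxHeartbeats 10000000 in
set_option maxRecDepth 200000 in
/-- Chunk 2 of the A = 5 table run (steps 50 … 74). [folklore] -/
theorem run2 : runSteps 60 12 3 GIt RbIt Bc2 chunk2 246960474301153 = some Bc3 := by
  decide +kernel

set_option maxHeartbeats 10000000 in
set_option maxRecDepth 200000 in
/-- Chunk 3 of the A = 5 table run (steps 75 … 99). [folklore] -/
theorem run3 : runSteps 60 12 3 GIt RbIt Bc3 chunk3 270331369697106 = some Bc4 := by
  decide +kernel

end ThresholdLevelTableA5

end Literature.Analysis.FluidPDE.FluidComputer
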